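import Literature.MathematicalPhysics.QuantumLattice.PairSourcedTorusGibbsTrialStateLimit
import Literature.MathematicalPhysics.QuantumLattice.TorusLimitOfMixturesCompactness
import Literature.MathematicalPhysics.QuantumLattice.PairSourcedTorusGibbsTrialStateMixing
import HarnessLib


/-!
# Torus-limit trial states from Gibbs rows on EVEN tori, and the two-family mixture (even-torus variants)

The theorems `exists_isTranslationInvariant_density_mem_Icc_meanEnergy_sourced_le_of_gibbs_rows` and
`exists_isTranslationInvariant_density_eq_meanEnergy_sourced_le_of_two_gibbs_families` of
`PairSourcedTorusGibbsTrialStateMixing` ask for a Hermitian trial matrix on EVERY torus `L ≥ L₀`; their proofs take the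
van Hove limit along one sequence of tori. Trial families with a two-sublattice structure (antiferromagnetic /
spin-density-wave + BCS quasi-free states) exist only on EVEN tori. This file records the same two statements with rows
on even tori only — the limit is taken along `L = 2(j + L₀ + 1)`; the proofs are otherwise verbatim.

References: Bratteli–Robinson I §4.3.1 [BratteliRobinsonI1987]; Bach–Lieb–Solovej (1994) §2 [BachLiebSolovej1994];
Ruelle (1969) §3.4 [Ruelle1969].
-/

noncomputable section

namespace Literature.MathematicalPhysics.QuantumLattice

open Matrix Finset HubbardWave0 _root_.Filter Literature.Probability.LatticeModels ThermodynamicLimit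
open scoped _root_.Topology ComplexOrder BigOperators

section ExistenceEven

/-- **Even-torus variant** (rows only on EVEN tori `L ≥ L₀`, for trial families — e.g. two-sublattice / antiferromagnetic ones — that live on even tori; the torus limit is taken along `L = 2(j + L₀ + 1)`). **One Gibbs trial family, interval rows.** Suppose that on every torus of side `L ≥ L₀` there is a
Hermitian trial matrix `B` whose Gibbs state at inverse temperature `β` has number per site
`n_L = Re⟨N⟩_{β,B}/L²` within `[a − c/L, b + c/L]` and sourced energy per site
`Re⟨A_L(h)⟩_{β,B}/L² ≤ C + μ'·n_L + U'·n_L²/4 + c/L` (`A_L(h) = dWaveSourceTorusTT' L tp U μ h`). Then SOME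
translation-invariant state `σ` on `ℤ²` has `a ≤ σ.density ≤ b` and
`e^{src}_h(σ) ≤ C + μ'·σ.density + U'·σ.density²/4` — a torus limit of the eigen-mixtures `e^{−βB}/Z`
(weak-⋆ compactness; §1–§2). [cite: BratteliRobinsonI1987, §4.3.1] [cite: BachLiebSolovej1994, §2] -/
theorem exists_isTranslationInvariant_density_mem_Icc_meanEnergy_sourced_le_of_gibbs_rows_even
    (tp U μ h β : ℝ) (L₀ : ℕ) {a b C μ' U' c : ℝ}
    (hrows : ∀ L : ℕ, L₀ ≤ L → Even L → ∀ [NeZero L],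
      ∃ B : Matrix (Finset (Orb (FermionTorus 2 L))) (Finset (Orb (FermionTorus 2 L))) ℂ, B.IsHermitian ∧
        a - c / (L : ℝ) ≤ (gibbsState β B totalNumber).re / (L : ℝ) ^ 2 ∧
        (gibbsState β B totalNumber).re / (L : ℝ) ^ 2 ≤ b + c / (L : ℝ) ∧
        (gibbsState β B (dWaveSourceTorusTT' L tp U μ h)).re / (L : ℝ) ^ 2 ≤
          C + μ' * ((gibbsState β B totalNumber).re / (L : ℝ) ^ 2) +
            U' * ((gibbsState β B totalNumber).re / (L : ℝ) ^ 2) ^ 2 / 4 + c / (L : ℝ)) :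
    ∃ σ : InfVolFermionState 2, σ.IsTranslationInvariant ∧ a ≤ σ.density ∧ σ.density ≤ b ∧
      σ.meanEnergy (hubbardTTPrimeSourcedInteraction 1 tp U μ dWaveFormFactor h) 1 ≤
        C + μ' * σ.density + U' * σ.density ^ 2 / 4 := by
  classical
  -- a Hermitian trial matrix with the rows on every admissible torus (junk `0` elsewhere)
  have hex : ∀ L : ℕ, ∃ B : Matrix (Finset (Orb (FermionTorus 2 L))) (Finset (Orb (FermionTorus 2 L))) ℂ,
      B.IsHermitian ∧ ∀ (hL : L₀ ≤ L) (hev : Even L) (hL0 : L ≠ 0),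
        a - c / (L : ℝ) ≤ (gibbsState β B totalNumber).re / (L : ℝ) ^ 2 ∧
        (gibbsState β B totalNumber).re / (L : ℝ) ^ 2 ≤ b + c / (L : ℝ) ∧
        (gibbsState β B (@dWaveSourceTorusTT' L ⟨hL0⟩ tp U μ h)).re / (L : ℝ) ^ 2 ≤
          C + μ' * ((gibbsState β B totalNumber).re / (L : ℝ) ^ 2) +
            U' * ((gibbsState β B totalNumber).re / (L : ℝ) ^ 2) ^ 2 / 4 + c / (L : ℝ) := by
    intro L
    by_cases hc : L₀ ≤ L ∧ Even L ∧ L ≠ 0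
    · obtain ⟨B, hB, hrow⟩ := @hrows L hc.1 hc.2.1 ⟨hc.2.2⟩
      exact ⟨B, hB, fun _ _ _ => hrow⟩
    · exact ⟨0, Matrix.isHermitian_zero, fun hL hev hL0 => absurd ⟨hL, hev, hL0⟩ hc⟩
  choose B hB hrow using hex
  -- the eigen-mixture data of the Gibbs states of `B L`
  set ι : ℕ → Type := fun L => Finset (Orb (FermionTorus 2 L)) with hι
  let m : ℕ → ℕ := fun L => Fintype.card (Finset (Orb (FermionTorus 2 L)))
  let e : ∀ L, Fin (m L) ≃ Finset (Orb (FermionTorus 2 L)) := fun L => (Fintype.equivFin _).symm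
  let p : ∀ L, Fin (m L) → ℝ := fun L i => canonicalWeight β (hB L).eigenvalues (e L i)
  let ψ : ∀ L, Fin (m L) → Fock (Orb (FermionTorus 2 L)) := fun L i s =>
    ((hB L).eigenvectorUnitary : Matrix _ _ ℂ) s (e L i)
  set Ls : ℕ → ℕ := fun j => 2 * (j + L₀ + 1) with hLs_def
  have hLs : Tendsto Ls atTop atTop := by
    refine tendsto_atTop_atTop.2 fun N => ⟨N, fun j hj => ?_⟩
    simp only [hLs_def]; omega
  haveI hL0 : ∀ j, NeZero (Ls j) := fun j => ⟨by simp only [hLs_def]; omega⟩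
  have hp0 : ∀ j i, 0 ≤ p (Ls j) i := fun j i => canonicalWeight_nonneg β _ _
  have hp1 : ∀ j, ∑ i, p (Ls j) i = 1 := by
    intro j
    haveI : Nonempty (Finset (Orb (FermionTorus 2 (Ls j)))) := ⟨∅⟩
    show ∑ i, canonicalWeight β (hB (Ls j)).eigenvalues (e (Ls j) i) = 1
    rw [Equiv.sum_comp (e (Ls j)) (fun a => canonicalWeight β (hB (Ls j)).eigenvalues a)]
    exact sum_canonicalWeight β _
  have hψ1 : ∀ j i, star (ψ (Ls j) i) ⬝ᵥ ψ (Ls j) i = 1 := fun j i =>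
    star_eigenvectorUnitary_col_dotProduct_self (hB (Ls j)) (e (Ls j) i)
  -- the weighted expectations are Gibbs expectations
  have hmix : ∀ (L : ℕ) (Y : Matrix (Finset (Orb (FermionTorus 2 L))) (Finset (Orb (FermionTorus 2 L))) ℂ),
      ∑ i, p L i * (QuantumLattice.expect Y (ψ L i)).re = (gibbsState β (B L) Y).re := by
    intro L Y
    rw [← sum_canonicalWeight_mul_re_expect_eigenvectorUnitary_eq (B L) (hB L) β Y]
    exact Equiv.sum_comp (e L) (fun a => canonicalWeight β (hB L).eigenvalues a *
      (star (fun s => ((hB L).eigenvectorUnitary : Matrix _ _ ℂ) s a) ⬝ᵥ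
        (Y *ᵥ fun s => ((hB L).eigenvectorUnitary : Matrix _ _ ℂ) s a)).re)
  have hmixN : ∀ L : ℕ, ∑ i, p L i * ((QuantumLattice.expect totalNumber (ψ L i)).re / (L : ℝ) ^ 2) =
      (gibbsState β (B L) totalNumber).re / (L : ℝ) ^ 2 := by
    intro L
    rw [← hmix L totalNumber, Finset.sum_div]
    exact Finset.sum_congr rfl fun i _ => (mul_div_assoc _ _ _).symm
  have hmixE : ∀ (L : ℕ) [NeZero L], ∑ i, p L i *
      ((QuantumLattice.expect (dWaveSourceTorusTT' L tp U μ h) (ψ L i)).re / (L : ℝ) ^ 2) =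
      (gibbsState β (B L) (dWaveSourceTorusTT' L tp U μ h)).re / (L : ℝ) ^ 2 := by
    intro L _
    rw [← hmix L (dWaveSourceTorusTT' L tp U μ h), Finset.sum_div]
    exact Finset.sum_congr rfl fun i _ => (mul_div_assoc _ _ _).symm
  -- compactness
  obtain ⟨φ, hφ, σ, hσ⟩ := InfVolFermionState.exists_isTorusLimitOfMixture_subseq p ψ hLs hp0 hp1 hψ1
  have hLφ : Tendsto (Ls ∘ φ) atTop atTop := hLs.comp hφ.tendsto_atTop
  haveI hL0' : ∀ j, NeZero ((Ls ∘ φ) j) := fun j => hL0 (φ j)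
  have hrowj : ∀ j, a - c / ((Ls ∘ φ) j : ℝ) ≤ (gibbsState β (B ((Ls ∘ φ) j)) totalNumber).re / ((Ls ∘ φ) j : ℝ) ^ 2 ∧
      (gibbsState β (B ((Ls ∘ φ) j)) totalNumber).re / ((Ls ∘ φ) j : ℝ) ^ 2 ≤ b + c / ((Ls ∘ φ) j : ℝ) ∧
      (gibbsState β (B ((Ls ∘ φ) j)) (dWaveSourceTorusTT' ((Ls ∘ φ) j) tp U μ h)).re / ((Ls ∘ φ) j : ℝ) ^ 2 ≤
        C + μ' * ((gibbsState β (B ((Ls ∘ φ) j)) totalNumber).re / ((Ls ∘ φ) j : ℝ) ^ 2) +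
          U' * ((gibbsState β (B ((Ls ∘ φ) j)) totalNumber).re / ((Ls ∘ φ) j : ℝ) ^ 2) ^ 2 / 4 +
          c / ((Ls ∘ φ) j : ℝ) := fun j =>
    hrow ((Ls ∘ φ) j) (by simp only [Function.comp_apply, hLs_def]; omega)
      ⟨φ j + L₀ + 1, by simp only [Function.comp_apply, hLs_def]; ring⟩ (hL0' j).ne
  obtain ⟨ha, hb⟩ := hσ.density_mem_Icc_of_eventually hLφ (a := a) (b := b) (c := c)
    (Eventually.of_forall fun j => by rw [hmixN ((Ls ∘ φ) j)]; exact (hrowj j).1)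
    (Eventually.of_forall fun j => by rw [hmixN ((Ls ∘ φ) j)]; exact (hrowj j).2.1)
  refine ⟨σ, hσ.isTranslationInvariant, ha, hb, ?_⟩
  exact hσ.meanEnergy_sourced_le_quad_density_of_eventually hLφ tp U μ h
    (Eventually.of_forall fun j => by rw [hmixE ((Ls ∘ φ) j), hmixN ((Ls ∘ φ) j)]; exact (hrowj j).2.2)

/-- **Even-torus variant** (rows on even tori only). **Two Gibbs trial families bracketing the density, and the mixture — the canonical-class cap `hcap` with
INTERVAL densities.** Family 1 (rows as above with `[a₁, b₁]`, `C₁`, `μ'₁`, `β₁`) and family 2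
(`[a₂, b₂]`, `C₂`, `μ'₂`, `β₂`), common `U' ≥ 0`, with `a₁ ≤ b₁ < n < a₂ ≤ b₂`, and the FOUR CORNER conditions
`(d₂ − n)·q₁(d₁) + (n − d₁)·q₂(d₂) ≤ u·(d₂ − d₁)` for `d₁ ∈ {a₁, b₁}`, `d₂ ∈ {a₂, b₂}`,
`qᵢ(d) = Cᵢ + μ'ᵢ d + U' d²/4`: SOME translation-invariant state of density EXACTLY `n` has `e^{src}_h ≤ u`.
(Mix the two limits with the weight `(d₂ − n)/(d₂ − d₁)` of their actual densities `dᵢ ∈ [aᵢ, bᵢ]`; the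
defect `(d₂ − n)q₁(d₁) + (n − d₁)q₂(d₂) − u(d₂ − d₁)` is convex in each `dᵢ` separately, so it is below its
largest corner value.) [cite: BratteliRobinsonI1987, §4.3.1] [cite: Ruelle1969, §3.4] -/
theorem exists_isTranslationInvariant_density_eq_meanEnergy_sourced_le_of_two_gibbs_families_even
    (tp U μ h β₁ β₂ : ℝ) (L₁ L₂ : ℕ) {a₁ b₁ C₁ μ'₁ a₂ b₂ C₂ μ'₂ U' c₁ c₂ n u : ℝ} (hU' : 0 ≤ U')
    (hrows₁ : ∀ L : ℕ, L₁ ≤ L → Even L → ∀ [NeZero L],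
      ∃ B : Matrix (Finset (Orb (FermionTorus 2 L))) (Finset (Orb (FermionTorus 2 L))) ℂ, B.IsHermitian ∧
        a₁ - c₁ / (L : ℝ) ≤ (gibbsState β₁ B totalNumber).re / (L : ℝ) ^ 2 ∧
        (gibbsState β₁ B totalNumber).re / (L : ℝ) ^ 2 ≤ b₁ + c₁ / (L : ℝ) ∧
        (gibbsState β₁ B (dWaveSourceTorusTT' L tp U μ h)).re / (L : ℝ) ^ 2 ≤
          C₁ + μ'₁ * ((gibbsState β₁ B totalNumber).re / (L : ℝ) ^ 2) +
            U' * ((gibbsState β₁ B totalNumber).re / (L : ℝ) ^ 2) ^ 2 / 4 + c₁ / (L : ℝ))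
    (hrows₂ : ∀ L : ℕ, L₂ ≤ L → Even L → ∀ [NeZero L],
      ∃ B : Matrix (Finset (Orb (FermionTorus 2 L))) (Finset (Orb (FermionTorus 2 L))) ℂ, B.IsHermitian ∧
        a₂ - c₂ / (L : ℝ) ≤ (gibbsState β₂ B totalNumber).re / (L : ℝ) ^ 2 ∧
        (gibbsState β₂ B totalNumber).re / (L : ℝ) ^ 2 ≤ b₂ + c₂ / (L : ℝ) ∧
        (gibbsState β₂ B (dWaveSourceTorusTT' L tp U μ h)).re / (L : ℝ) ^ 2 ≤
          C₂ + μ'₂ * ((gibbsState β₂ B totalNumber).re / (L : ℝ) ^ 2) +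
            U' * ((gibbsState β₂ B totalNumber).re / (L : ℝ) ^ 2) ^ 2 / 4 + c₂ / (L : ℝ))
    (hb₁ : b₁ < n) (ha₂ : n < a₂)
    (hcaa : (a₂ - n) * (C₁ + μ'₁ * a₁ + U' * a₁ ^ 2 / 4) + (n - a₁) * (C₂ + μ'₂ * a₂ + U' * a₂ ^ 2 / 4) ≤ u * (a₂ - a₁))
    (hcab : (b₂ - n) * (C₁ + μ'₁ * a₁ + U' * a₁ ^ 2 / 4) + (n - a₁) * (C₂ + μ'₂ * b₂ + U' * b₂ ^ 2 / 4) ≤ u * (b₂ - a₁))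
    (hcba : (a₂ - n) * (C₁ + μ'₁ * b₁ + U' * b₁ ^ 2 / 4) + (n - b₁) * (C₂ + μ'₂ * a₂ + U' * a₂ ^ 2 / 4) ≤ u * (a₂ - b₁))
    (hcbb : (b₂ - n) * (C₁ + μ'₁ * b₁ + U' * b₁ ^ 2 / 4) + (n - b₁) * (C₂ + μ'₂ * b₂ + U' * b₂ ^ 2 / 4) ≤ u * (b₂ - b₁)) :
    ∃ σ : InfVolFermionState 2, σ.IsTranslationInvariant ∧ σ.density = n ∧
      σ.meanEnergy (hubbardTTPrimeSourcedInteraction 1 tp U μ dWaveFormFactor h) 1 ≤ u := by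
  obtain ⟨ω₁, hω₁, ha₁', hb₁', hE₁⟩ :=
    exists_isTranslationInvariant_density_mem_Icc_meanEnergy_sourced_le_of_gibbs_rows_even tp U μ h β₁ L₁ hrows₁
  obtain ⟨ω₂, hω₂, ha₂', hb₂', hE₂⟩ :=
    exists_isTranslationInvariant_density_mem_Icc_meanEnergy_sourced_le_of_gibbs_rows_even tp U μ h β₂ L₂ hrows₂
  set d₁ := ω₁.density with hd₁
  set d₂ := ω₂.density with hd₂
  have hlt₁ : d₁ < n := lt_of_le_of_lt hb₁' hb₁
  have hlt₂ : n < d₂ := lt_of_lt_of_le ha₂ ha₂'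
  refine InfVolFermionState.exists_isTranslationInvariant_density_eq_meanEnergy_le' hω₁ hω₂ rfl rfl
    (hlt₁.trans hlt₂) hlt₁.le hlt₂.le _ 1 hE₁ hE₂ ?_
  -- the defect `P(d₁, d₂) = (d₂ − n) q₁(d₁) + (n − d₁) q₂(d₂) − u (d₂ − d₁)` is separately convex: corner bound
  -- step 1: in `d₁` (fixed `d₂ ≥ n`), `P` is a convex quadratic with leading coefficient `(d₂ − n)·U'/4 ≥ 0`
  have hα₁ : 0 ≤ (d₂ - n) * U' / 4 := by nlinarith
  have step1 : ∀ y : ℝ, n ≤ y →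
      (y - n) * (C₁ + μ'₁ * d₁ + U' * d₁ ^ 2 / 4) + (n - d₁) * (C₂ + μ'₂ * y + U' * y ^ 2 / 4) - u * (y - d₁) ≤
        max ((y - n) * (C₁ + μ'₁ * a₁ + U' * a₁ ^ 2 / 4) + (n - a₁) * (C₂ + μ'₂ * y + U' * y ^ 2 / 4) - u * (y - a₁))
          ((y - n) * (C₁ + μ'₁ * b₁ + U' * b₁ ^ 2 / 4) + (n - b₁) * (C₂ + μ'₂ * y + U' * y ^ 2 / 4) - u * (y - b₁)) := by
    intro y hy
    have hαy : 0 ≤ (y - n) * U' / 4 := by nlinarith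
    have key := convexQuad_le_max_endpoints (α := (y - n) * U' / 4)
      (β := (y - n) * μ'₁ - (C₂ + μ'₂ * y + U' * y ^ 2 / 4) + u) (γ := (y - n) * C₁ + n * (C₂ + μ'₂ * y + U' * y ^ 2 / 4) - u * y)
      hαy ha₁' hb₁'
    have e0 : ∀ x : ℝ, (y - n) * U' / 4 * x ^ 2 + ((y - n) * μ'₁ - (C₂ + μ'₂ * y + U' * y ^ 2 / 4) + u) * x +
        ((y - n) * C₁ + n * (C₂ + μ'₂ * y + U' * y ^ 2 / 4) - u * y) =
        (y - n) * (C₁ + μ'₁ * x + U' * x ^ 2 / 4) + (n - x) * (C₂ + μ'₂ * y + U' * y ^ 2 / 4) - u * (y - x) := by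
      intro x; ring
    rw [e0, e0, e0] at key
    exact key
  -- step 2: in `d₂` (fixed `d₁ ≤ n`), convex with leading coefficient `(n − d₁)·U'/4 ≥ 0`
  have step2 : ∀ x : ℝ, x ≤ n →
      (d₂ - n) * (C₁ + μ'₁ * x + U' * x ^ 2 / 4) + (n - x) * (C₂ + μ'₂ * d₂ + U' * d₂ ^ 2 / 4) - u * (d₂ - x) ≤
        max ((a₂ - n) * (C₁ + μ'₁ * x + U' * x ^ 2 / 4) + (n - x) * (C₂ + μ'₂ * a₂ + U' * a₂ ^ 2 / 4) - u * (a₂ - x))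
          ((b₂ - n) * (C₁ + μ'₁ * x + U' * x ^ 2 / 4) + (n - x) * (C₂ + μ'₂ * b₂ + U' * b₂ ^ 2 / 4) - u * (b₂ - x)) := by
    intro x hx
    have hαx : 0 ≤ (n - x) * U' / 4 := by nlinarith
    have key := convexQuad_le_max_endpoints (α := (n - x) * U' / 4)
      (β := (C₁ + μ'₁ * x + U' * x ^ 2 / 4) + (n - x) * μ'₂ - u) (γ := -n * (C₁ + μ'₁ * x + U' * x ^ 2 / 4) + (n - x) * C₂ + u * x)
      hαx ha₂' hb₂'
    have e0 : ∀ y : ℝ, (n - x) * U' / 4 * y ^ 2 + ((C₁ + μ'₁ * x + U' * x ^ 2 / 4) + (n - x) * μ'₂ - u) * y +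
        (-n * (C₁ + μ'₁ * x + U' * x ^ 2 / 4) + (n - x) * C₂ + u * x) =
        (y - n) * (C₁ + μ'₁ * x + U' * x ^ 2 / 4) + (n - x) * (C₂ + μ'₂ * y + U' * y ^ 2 / 4) - u * (y - x) := by
      intro y; ring
    rw [e0, e0, e0] at key
    exact key
  have hA : (d₂ - n) * (C₁ + μ'₁ * a₁ + U' * a₁ ^ 2 / 4) + (n - a₁) * (C₂ + μ'₂ * d₂ + U' * d₂ ^ 2 / 4) - u * (d₂ - a₁) ≤ 0 :=
    (step2 a₁ (ha₁'.trans hlt₁.le)).trans (max_le (by linarith) (by linarith))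
  have hB : (d₂ - n) * (C₁ + μ'₁ * b₁ + U' * b₁ ^ 2 / 4) + (n - b₁) * (C₂ + μ'₂ * d₂ + U' * d₂ ^ 2 / 4) - u * (d₂ - b₁) ≤ 0 :=
    (step2 b₁ hb₁.le).trans (max_le (by linarith) (by linarith))
  have hfin := (step1 d₂ hlt₂.le).trans (max_le hA hB)
  linarith

end ExistenceEven

end Literature.MathematicalPhysics.QuantumLattice

end
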